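import Mathlib
import HarnessLib

/-!
# `det(1 − U) = conj(tr U) − tr U` on `SU(3)`: an `SU(3)` matrix fixes a non-zero vector iff its trace is real, and `|det(1 − U)| = 2 |Im tr U|`

HONEST FRAMING: exact (Metropolis-corrected) sampling algorithms for lattice gauge theory;
figures of merit are autocorrelation/cost numbers at stated couplings and volumes; no
continuum-physics claim.

Venture `LatticeQCDFlow` (cell pub-lqcd), sub-topic `Scoring`; FANOUT row 21 (`su3-base`: the 4D
`SU(3)` baselines).  NEW WORK of the cell (placement rule), Mathlib-only and elementary; no definition
is introduced; nothing is cited as a fact; no number of ours.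

For a `3 × 3` matrix `det(1 − M) = 1 − e₁ + e₂ − e₃` with `e₁ = tr M`, `e₂ = tr adj M`, `e₃ = det M`
(the characteristic polynomial at `1`).  On `SU(3)`, `e₂ = conj(tr U)` (the adjugate is `U†`) and
`e₃ = 1`, so

  `det(1 − U) = conj(tr U) − tr U = −2i · Im tr U`.

Consequences: `|det(1 − U)| = 2 |Im tr U|`; `U` has the eigenvalue `1` — it FIXES a non-zero vector
of `ℂ³`, i.e. it lies in a conjugate of the embedded `SU(2)` — iff `Im tr U = 0`; in particular
every element of the three Cabibbo–Marinari `SU(2)` subgroups used by the E1 heat bath has real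
trace, and (contrapositive) a link or plaquette matrix with `Im tr U ≠ 0` moves every non-zero
vector.  (Companion files: `Scoring/SU3ConjugacyByTrace` — the trace decides the class — and
`Scoring/SU3TraceDeltoid` — a real trace forces `−1 ≤ tr U ≤ 3`.)

## What is proved

* §1 (`3 × 3`, any commutative ring) **`det_one_sub_fin_three`**:
  `det(1 − M) = 1 − tr M + tr adj M − det M`.
* §2 (`SU(3)`) **`su3_det_one_sub_eq`**: `det(1 − U) = conj(tr U) − tr U`;
  `su3_det_one_sub_eq_im` (`= −(2 Im tr U)·i`); **`su3_norm_det_one_sub`**: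
  `‖det(1 − U)‖ = 2 |Im tr U|`; **`su3_exists_fixed_vector_iff_im_trace_eq_zero`**:
  `(∃ v ≠ 0, U v = v) ⇔ Im tr U = 0`; `su3_det_one_sub_ne_zero_of_im_trace_ne_zero`.

(The embedded `SU(2)` side — the trace of an `SU(2)` matrix is real — is the Literature's
`QuantumLattice/NarrowWellPlaquetteAction.trace_im_eq_zero`, not restated here.)

NOT CLAIMED: the converse conjugation statement (that a real-trace element IS conjugate INTO the
standard embedded `SU(2)`, which needs a unitary completion of the fixed vector); anything for
`N ≠ 3`.
-/

namespace Summit.Ventures.LatticeQCDFlow.Scoring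

open Matrix

/-! ## §1 `det(1 − M)` for a `3 × 3` matrix -/

section AnyRing

variable {R : Type*} [CommRing R]

/-- **`det(1 − M) = 1 − tr M + tr adj M − det M`** for `3 × 3` matrices (the characteristic
polynomial evaluated at `1`). -/
theorem det_one_sub_fin_three (M : Matrix (Fin 3) (Fin 3) R) :
    (1 - M).det = 1 - M.trace + (adjugate M).trace - M.det := by
  have hadj : (adjugate M).trace = M 1 1 * M 2 2 - M 1 2 * M 2 1 + (M 0 0 * M 2 2 - M 0 2 * M 2 0)
      + (M 0 0 * M 1 1 - M 0 1 * M 1 0) := by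
    simp [adjugate_fin_three, trace_fin_three]
  rw [hadj, det_fin_three, det_fin_three, trace_fin_three]
  simp
  ring

end AnyRing

/-! ## §2 `SU(3)`: `det(1 − U) = conj(tr U) − tr U` -/

section SpecialUnitaryThree

/-- **`det(1 − U) = conj(tr U) − tr U`** for `U ∈ SU(3)` (`tr adj U = conj tr U` because
`adj U = U†`, and `det U = 1`). -/
theorem su3_det_one_sub_eq (U : Matrix.specialUnitaryGroup (Fin 3) ℂ) :
    (1 - (U : Matrix (Fin 3) (Fin 3) ℂ)).det =
      (starRingEnd ℂ) (U : Matrix (Fin 3) (Fin 3) ℂ).trace - (U : Matrix (Fin 3) (Fin 3) ℂ).trace := by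
  have hU := U.2
  have hunit : (U : Matrix (Fin 3) (Fin 3) ℂ) ∈ Matrix.unitaryGroup (Fin 3) ℂ :=
    (Matrix.mem_specialUnitaryGroup_iff.mp hU).1
  have hdet : (U : Matrix (Fin 3) (Fin 3) ℂ).det = 1 := (Matrix.mem_specialUnitaryGroup_iff.mp hU).2
  have hadj : adjugate (U : Matrix (Fin 3) (Fin 3) ℂ) = star (U : Matrix (Fin 3) (Fin 3) ℂ) := by
    have h1 : (U : Matrix (Fin 3) (Fin 3) ℂ) * adjugate (U : Matrix (Fin 3) (Fin 3) ℂ) = 1 := by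
      rw [mul_adjugate, hdet, one_smul]
    have h2 : star (U : Matrix (Fin 3) (Fin 3) ℂ) * (U : Matrix (Fin 3) (Fin 3) ℂ) = 1 :=
      Unitary.star_mul_self_of_mem hunit
    calc adjugate (U : Matrix (Fin 3) (Fin 3) ℂ)
        = (star (U : Matrix (Fin 3) (Fin 3) ℂ) * (U : Matrix (Fin 3) (Fin 3) ℂ)) *
            adjugate (U : Matrix (Fin 3) (Fin 3) ℂ) := by rw [h2, Matrix.one_mul]
      _ = star (U : Matrix (Fin 3) (Fin 3) ℂ) *
            ((U : Matrix (Fin 3) (Fin 3) ℂ) * adjugate (U : Matrix (Fin 3) (Fin 3) ℂ)) := by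
          rw [Matrix.mul_assoc]
      _ = star (U : Matrix (Fin 3) (Fin 3) ℂ) := by rw [h1, Matrix.mul_one]
  have htr : (adjugate (U : Matrix (Fin 3) (Fin 3) ℂ)).trace =
      (starRingEnd ℂ) (U : Matrix (Fin 3) (Fin 3) ℂ).trace := by
    rw [hadj, star_eq_conjTranspose, trace_conjTranspose, Complex.star_def]
  rw [det_one_sub_fin_three, htr, hdet]
  ring

/-- `det(1 − U) = −(2 Im tr U)·i` on `SU(3)`. -/
theorem su3_det_one_sub_eq_im (U : Matrix.specialUnitaryGroup (Fin 3) ℂ) :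
    (1 - (U : Matrix (Fin 3) (Fin 3) ℂ)).det =
      -((2 * ((U : Matrix (Fin 3) (Fin 3) ℂ).trace).im : ℝ) : ℂ) * Complex.I := by
  rw [su3_det_one_sub_eq]
  apply Complex.ext
  · simp
  · simp; ring

/-- **`‖det(1 − U)‖ = 2 |Im tr U|`** on `SU(3)`. -/
theorem su3_norm_det_one_sub (U : Matrix.specialUnitaryGroup (Fin 3) ℂ) :
    ‖(1 - (U : Matrix (Fin 3) (Fin 3) ℂ)).det‖ = 2 * |((U : Matrix (Fin 3) (Fin 3) ℂ).trace).im| := by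
  rw [su3_det_one_sub_eq_im, norm_mul, norm_neg, Complex.norm_real, Complex.norm_I, mul_one,
    Real.norm_eq_abs, abs_mul, abs_of_pos (by norm_num : (0 : ℝ) < 2)]

/-- `det(1 − U) = 0` iff `Im tr U = 0`, for `U ∈ SU(3)`. -/
theorem su3_det_one_sub_eq_zero_iff (U : Matrix.specialUnitaryGroup (Fin 3) ℂ) :
    (1 - (U : Matrix (Fin 3) (Fin 3) ℂ)).det = 0 ↔ ((U : Matrix (Fin 3) (Fin 3) ℂ).trace).im = 0 := by
  rw [← norm_eq_zero, su3_norm_det_one_sub, mul_eq_zero, abs_eq_zero]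
  norm_num

/-- **An `SU(3)` matrix fixes a non-zero vector iff its trace is real**:
`(∃ v ≠ 0, U v = v) ⇔ Im tr U = 0`. -/
theorem su3_exists_fixed_vector_iff_im_trace_eq_zero (U : Matrix.specialUnitaryGroup (Fin 3) ℂ) :
    (∃ v : Fin 3 → ℂ, v ≠ 0 ∧ (U : Matrix (Fin 3) (Fin 3) ℂ) *ᵥ v = v) ↔
      ((U : Matrix (Fin 3) (Fin 3) ℂ).trace).im = 0 := by
  rw [← su3_det_one_sub_eq_zero_iff, ← Matrix.exists_mulVec_eq_zero_iff]
  constructor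
  · rintro ⟨v, hv, h⟩
    exact ⟨v, hv, by rw [sub_mulVec, one_mulVec, h, sub_self]⟩
  · rintro ⟨v, hv, h⟩
    refine ⟨v, hv, ?_⟩
    rw [sub_mulVec, one_mulVec, sub_eq_zero] at h
    exact h.symm

/-- Contrapositive, the generic case: if `Im tr U ≠ 0` then `U ∈ SU(3)` moves every non-zero vector
(`1 − U` is invertible). -/
theorem su3_det_one_sub_ne_zero_of_im_trace_ne_zero (U : Matrix.specialUnitaryGroup (Fin 3) ℂ)
    (h : ((U : Matrix (Fin 3) (Fin 3) ℂ).trace).im ≠ 0) :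
    (1 - (U : Matrix (Fin 3) (Fin 3) ℂ)).det ≠ 0 := by
  rwa [ne_eq, su3_det_one_sub_eq_zero_iff]

end SpecialUnitaryThree


end Summit.Ventures.LatticeQCDFlow.Scoring
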